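import Mathlib.Combinatorics.Additive.AP.Three.Defs
import Literature.Computability.AlgebraicComplexity.LaserHashing
import HarnessLib

/-!
# The hash family of asymmetric hashing and its independence properties
(Vassilevska Williams–Xu–Xu–Zhou 2024, §5.2, Claim 5.5) — proved

Topic `Literature/Computability/AlgebraicComplexity`.  §5.2 of Vassilevska Williams–Xu–Xu–Zhou,
*New bounds for matrix multiplication: from alpha to omega* (SODA 2024, arXiv:2307.07970; the same
family in Duan–Wu–Zhou 2023 and, symmetrically, in Coppersmith–Winograd 1990 §6):

> We independently pick uniformly random elements `b₀, {w_t}_{t=0}^n ∈ {0, …, M−1}`, and define the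
> hash functions `h_X, h_Y, h_Z : {0, …, 2^ℓ}^n → {0, …, M−1}`:
> `h_X(I) = b₀ + (∑_{t=1}^n w_t I_t) mod M`, `h_Y(J) = b₀ + (w₀ + ∑ w_t J_t) mod M`,
> `h_Z(K) = b₀ + ½ (w₀ + ∑ w_t (2^ℓ − K_t)) mod M`. … For every block triple `X_I Y_J Z_K` we have
> `I_t + J_t + K_t = 2^ℓ` for every `t`, therefore `h_X(I) + h_Y(J) ≡ 2 h_Z(K) (mod M)`. In order for
> `h_X(I), h_Y(J), h_Z(K) ∈ B` [a Salem–Spencer set], we must have `h_X(I) = h_Y(J) = h_Z(K) = b`.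
>
> **Claim 5.5 (Implicit in [CW90], see also [DWZ23]).** For a block triple `X_I Y_J Z_K` and every
> `b`, `Pr[h_X(I) = h_Y(J) = h_Z(K) = b] = 1/M²`.  Furthermore, for two different block triples
> `X_I Y_J Z_K`, `X_I Y_{J'} Z_{K'}` that share the same `X`-block and every `b`,
> `Pr[h_X(I) = h_Y(J') = h_Z(K') = b | h_X(I) = h_Y(J) = h_Z(K) = b] = 1/M`.  This also holds
> analogously for different block triples that share the same `Y`-block or `Z`-block.

This file PROVES these statements as exact counts over the seed space
`Ω = (ℤ/M) × (ℤ/M) × (ℤ/M)^n ∋ (b₀, w₀, w)` for a prime `M > 2` (the `½` is the inverse of `2`),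
for index sequences `I, J, K : Fin n → ℕ` of any "level sum" `P` (`= 2^ℓ`) with entries `< M`:

* `vxxzHashX/Y/Z` — the three hash functions; `vxxzHashX_add_vxxzHashY` — the arithmetic
  progression `h_X(I) + h_Y(J) = 2 h_Z(K)` on block triples (`I + J + K = P`), hence
  `vxxzHash_eq_of_threeAPFree` — in a 3-AP-free `B` all three hash values of a block triple with
  `h_X, h_Y, h_Z ∈ B` coincide ("contained in bucket `b`"), and `vxxzHashZ_eq_of_eq` —
  `h_X(I) = h_Y(J) = b ⇒ h_Z(K) = b`;
* `card_seeds_vxxzHash_bucket` — **Claim 5.5, first part**: exactly `|Ω|/M² = M^n` seeds put a given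
  block triple into bucket `b`;
* `card_seeds_vxxzHash_bucket_shareX` / `_shareY` / `_shareZ` — **Claim 5.5, second part**: for two
  different block triples sharing the `X`-block (resp. `Y`-, `Z`-block) exactly `|Ω|/M³` seeds put
  both into bucket `b` — `1/M` of the former (independence through a surjective homomorphism
  `Ω → (ℤ/M)³`, the third coordinate `w · (J − J')` having a unit coefficient because `J ≠ J'` have
  entries `< M`).

Everything is proved; three definitions (the hash functions); no named facts.

## References

* V. Vassilevska Williams, Y. Xu, Z. Xu, R. Zhou, *New bounds for matrix multiplication: from alpha
  to omega*, SODA 2024, arXiv:2307.07970 (held: `paper:arxiv-2307.07970`), §5.2 (the hash functions,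
  buckets) and Claim 5.5. [VassilevskaWilliamsXuXuZhou2024]
* R. Duan, H. Wu, R. Zhou, *Faster matrix multiplication via asymmetric hashing*, FOCS 2023,
  arXiv:2210.10173 (asymmetric hashing). [DuanWuZhou2022]
* D. Coppersmith, S. Winograd, *Matrix multiplication via arithmetic progressions*, J. Symbolic
  Comput. 9 (1990), §6 (the hash family and the Salem–Spencer argument). [CoppersmithWinograd1990]
-/

open scoped BigOperators
open Finset Matrix

namespace Literature.Computability.AlgebraicComplexity

/-! ## The hash functions -/

section Hash

variable {M : ℕ} {n : ℕ}

/-- The seed space `Ω = (b₀, w₀, w) ∈ ℤ/M × ℤ/M × (ℤ/M)^n` of the hash family. [cite: VassilevskaWilliamsXuXuZhou2024, §5.2] -/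
abbrev VxxzSeed (M n : ℕ) : Type := ZMod M × ZMod M × (Fin n → ZMod M)

/-- An index sequence read modulo `M`. [cite: VassilevskaWilliamsXuXuZhou2024, §5.2] -/
def seqMod (M : ℕ) (I : Fin n → ℕ) : Fin n → ZMod M := fun t => (I t : ZMod M)

/-- Entries of `seqMod`. [folklore] -/
@[simp] theorem seqMod_apply (I : Fin n → ℕ) (t : Fin n) : seqMod M I t = (I t : ZMod M) := rfl

/-- **`h_X(I) = b₀ + ∑_t w_t I_t`**. [cite: VassilevskaWilliamsXuXuZhou2024, §5.2] -/
def vxxzHashX (ω : VxxzSeed M n) (I : Fin n → ℕ) : ZMod M := ω.1 + ω.2.2 ⬝ᵥ seqMod M I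

/-- **`h_Y(J) = b₀ + w₀ + ∑_t w_t J_t`**. [cite: VassilevskaWilliamsXuXuZhou2024, §5.2] -/
def vxxzHashY (ω : VxxzSeed M n) (J : Fin n → ℕ) : ZMod M := ω.1 + ω.2.1 + ω.2.2 ⬝ᵥ seqMod M J

/-- **`h_Z(K) = b₀ + ½ (w₀ + ∑_t w_t (P − K_t))`** (`P = 2^ℓ`; `½ = 2⁻¹` in `ℤ/M`, `M` odd).
[cite: VassilevskaWilliamsXuXuZhou2024, §5.2] -/
def vxxzHashZ (P : ℕ) (ω : VxxzSeed M n) (K : Fin n → ℕ) : ZMod M :=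
  ω.1 + (2 : ZMod M)⁻¹ * (ω.2.1 + ω.2.2 ⬝ᵥ fun t => ((P : ZMod M) - (K t : ZMod M)))

/-- Unfolding of `h_X`. [cite: VassilevskaWilliamsXuXuZhou2024, §5.2] -/
theorem vxxzHashX_apply (ω : VxxzSeed M n) (I : Fin n → ℕ) :
    vxxzHashX ω I = ω.1 + ω.2.2 ⬝ᵥ seqMod M I := rfl

/-- Unfolding of `h_Y`. [cite: VassilevskaWilliamsXuXuZhou2024, §5.2] -/
theorem vxxzHashY_apply (ω : VxxzSeed M n) (J : Fin n → ℕ) :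
    vxxzHashY ω J = ω.1 + ω.2.1 + ω.2.2 ⬝ᵥ seqMod M J := rfl

/-- Unfolding of `h_Z`. [cite: VassilevskaWilliamsXuXuZhou2024, §5.2] -/
theorem vxxzHashZ_apply (P : ℕ) (ω : VxxzSeed M n) (K : Fin n → ℕ) :
    vxxzHashZ P ω K = ω.1 + (2 : ZMod M)⁻¹ * (ω.2.1 + ω.2.2 ⬝ᵥ fun t => ((P : ZMod M) - (K t : ZMod M))) :=
  rfl

/-- **The arithmetic progression `h_X(I) + h_Y(J) = 2 h_Z(K)` for a block triple** (`I + J + K = P`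
entrywise), `M` an odd prime. [cite: VassilevskaWilliamsXuXuZhou2024, §5.2 ("it is not difficult to verify that h_X(I) + h_Y(J) ≡ 2h_Z(K) mod M")] -/
theorem vxxzHashX_add_vxxzHashY [Fact M.Prime] (hM : M ≠ 2) {P : ℕ} (ω : VxxzSeed M n)
    {I J K : Fin n → ℕ} (h : ∀ t, I t + J t + K t = P) :
    vxxzHashX ω I + vxxzHashY ω J = 2 * vxxzHashZ P ω K := by
  have h2 : (2 : ZMod M) ≠ 0 := by
    intro h0
    have h0' : ((2 : ℕ) : ZMod M) = 0 := by exact_mod_cast h0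
    rw [CharP.cast_eq_zero_iff (ZMod M) M] at h0'
    exact hM ((Nat.prime_dvd_prime_iff_eq Fact.out Nat.prime_two).1 h0')
  have hsum : seqMod M I + seqMod M J = fun t => ((P : ZMod M) - (K t : ZMod M)) := by
    funext t
    simp only [Pi.add_apply, seqMod_apply]
    have h' := congrArg (Nat.cast (R := ZMod M)) (h t)
    push_cast at h'
    rw [eq_sub_iff_add_eq]
    exact h'
  rw [vxxzHashX_apply, vxxzHashY_apply, vxxzHashZ_apply, mul_add, ← mul_assoc, mul_inv_cancel₀ h2,
    one_mul, ← hsum, dotProduct_add]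
  ring

/-- `2` is invertible in `ℤ/M` for an odd prime `M`. [folklore] -/
theorem zmod_two_ne_zero [Fact M.Prime] (hM : M ≠ 2) : (2 : ZMod M) ≠ 0 := by
  intro h0
  have h0' : ((2 : ℕ) : ZMod M) = 0 := by exact_mod_cast h0
  rw [CharP.cast_eq_zero_iff (ZMod M) M] at h0'
  exact hM ((Nat.prime_dvd_prime_iff_eq Fact.out Nat.prime_two).1 h0')

/-- Hence `h_X(I) = h_Y(J) = b` already forces `h_Z(K) = b` for a block triple.
[cite: VassilevskaWilliamsXuXuZhou2024, §5.2] -/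
theorem vxxzHashZ_eq_of_eq [Fact M.Prime] (hM : M ≠ 2) {P : ℕ} (ω : VxxzSeed M n)
    {I J K : Fin n → ℕ} (h : ∀ t, I t + J t + K t = P) {b : ZMod M} (hX : vxxzHashX ω I = b)
    (hY : vxxzHashY ω J = b) : vxxzHashZ P ω K = b := by
  have hap := vxxzHashX_add_vxxzHashY hM ω h
  rw [hX, hY, ← two_mul] at hap
  exact (mul_left_cancel₀ (zmod_two_ne_zero hM) hap).symm

/-- **Buckets**: if `B ⊆ ℤ/M` contains no non-trivial 3-term arithmetic progression and the three
hash values of a block triple lie in `B`, then they are all equal ("we must have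
`h_X(I) = h_Y(J) = h_Z(K) = b` for some `b` … triples with … `= b` are contained in bucket `b`").
[cite: VassilevskaWilliamsXuXuZhou2024, §5.2] -/
theorem vxxzHash_eq_of_threeAPFree [Fact M.Prime] (hM : M ≠ 2) {P : ℕ} {B : Set (ZMod M)}
    (hB : ThreeAPFree B) (ω : VxxzSeed M n) {I J K : Fin n → ℕ} (h : ∀ t, I t + J t + K t = P)
    (hX : vxxzHashX ω I ∈ B) (hY : vxxzHashY ω J ∈ B) (hZ : vxxzHashZ P ω K ∈ B) :
    vxxzHashX ω I = vxxzHashZ P ω K ∧ vxxzHashY ω J = vxxzHashZ P ω K := by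
  have hap := vxxzHashX_add_vxxzHashY hM ω h
  rw [two_mul] at hap
  have h1 : vxxzHashX ω I = vxxzHashZ P ω K := hB hX hZ hY hap
  refine ⟨h1, ?_⟩
  rw [h1] at hap
  exact add_left_cancel hap

end Hash

/-! ## Claim 5.5: uniformity and pairwise independence of the buckets -/

section Counts

variable {M : ℕ} [Fact M.Prime] {n : ℕ}

/-- The cardinality of the seed space: `|Ω| = M^{n+2}`. [folklore] -/
theorem card_vxxzSeed : Fintype.card (VxxzSeed M n) = M ^ (n + 2) := by
  simp only [VxxzSeed, Fintype.card_prod, Fintype.card_fun, ZMod.card, Fintype.card_fin]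
  ring

/-- **Claim 5.5, first part: `Pr[h_X(I) = h_Y(J) = b] = 1/M²`** — exactly `M^n` of the `M^{n+2}`
seeds; for a block triple this is the event `h_X(I) = h_Y(J) = h_Z(K) = b` (`vxxzHashZ_eq_of_eq`).
Holds for arbitrary sequences `I, J` (the pair `(h_X(I), h_Y(J))` is a surjective homomorphism of
the seed). [cite: VassilevskaWilliamsXuXuZhou2024, Claim 5.5] -/
theorem card_seeds_vxxzHash_pair (I J : Fin n → ℕ) (b b' : ZMod M) :
    (univ.filter fun ω : VxxzSeed M n => vxxzHashX ω I = b ∧ vxxzHashY ω J = b').card * M ^ 2 =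
      M ^ (n + 2) := by
  classical
  let F : VxxzSeed M n →+ ZMod M × ZMod M :=
    { toFun := fun ω => (vxxzHashX ω I, vxxzHashY ω J)
      map_zero' := by simp [vxxzHashX, vxxzHashY]
      map_add' := fun ω ω' => by
        simp only [vxxzHashX, vxxzHashY, Prod.fst_add, Prod.snd_add, add_dotProduct, Prod.mk_add_mk,
          Prod.mk.injEq]
        constructor <;> ring }
  have hF : Function.Surjective F := fun p =>
    ⟨(p.1, p.2 - p.1, 0), by simp [F, vxxzHashX, vxxzHashY]⟩
  have h := card_filter_mul_card_eq_card_of_surjective F hF (b, b')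
  have hH : Fintype.card (ZMod M × ZMod M) = M ^ 2 := by
    simp only [Fintype.card_prod, ZMod.card]; ring
  rw [card_vxxzSeed, hH] at h
  rw [← h]
  congr 2
  refine Finset.filter_congr fun ω _ => ?_
  simp [F, Prod.ext_iff]

/-- **Claim 5.5, first part, for a block triple**: exactly `M^n` seeds (probability `1/M²`) give
`h_X(I) = h_Y(J) = h_Z(K) = b`. [cite: VassilevskaWilliamsXuXuZhou2024, Claim 5.5] -/
theorem card_seeds_vxxzHash_bucket (hM : M ≠ 2) {P : ℕ} {I J K : Fin n → ℕ}
    (h : ∀ t, I t + J t + K t = P) (b : ZMod M) :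
    (univ.filter fun ω : VxxzSeed M n =>
        vxxzHashX ω I = b ∧ vxxzHashY ω J = b ∧ vxxzHashZ P ω K = b).card * M ^ 2 = M ^ (n + 2) := by
  rw [← card_seeds_vxxzHash_pair I J b b]
  congr 2
  refine Finset.filter_congr fun ω _ => ?_
  exact ⟨fun h' => ⟨h'.1, h'.2.1⟩, fun h' => ⟨h'.1, h'.2, vxxzHashZ_eq_of_eq hM ω h h'.1 h'.2⟩⟩

/-- Two different index sequences with entries `< M` differ modulo `M` in some coordinate by a unit.
[cite: VassilevskaWilliamsXuXuZhou2024, §5.2 (M ≥ M₀ prime; sequences in {0,…,2^ℓ}^n)] -/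
theorem exists_seqMod_sub_ne_zero {J J' : Fin n → ℕ} (hJ : ∀ t, J t < M) (hJ' : ∀ t, J' t < M)
    (hne : J ≠ J') : ∃ t, seqMod M J t - seqMod M J' t ≠ 0 := by
  obtain ⟨t, ht⟩ := Function.ne_iff.1 hne
  refine ⟨t, fun h0 => ht ?_⟩
  rw [sub_eq_zero, seqMod_apply, seqMod_apply] at h0
  have := congrArg ZMod.val h0
  rwa [ZMod.val_natCast, ZMod.val_natCast, Nat.mod_eq_of_lt (hJ t), Nat.mod_eq_of_lt (hJ' t)] at this

/-- The count behind the second part of Claim 5.5: prescribing `h_X(I)`, `h_Y(J)` and the difference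
`w · (V − V')` (`= h_Y(V) − h_Y(V') = h_X(V) − h_X(V')`) of two sequences differing by a unit in some
coordinate leaves exactly `|Ω|/M³` seeds (a surjective homomorphism `Ω → (ℤ/M)³`).
[cite: VassilevskaWilliamsXuXuZhou2024, Claim 5.5] -/
theorem card_seeds_vxxzHash_pair_diff (I J : Fin n → ℕ) {V V' : Fin n → ℕ} {t₀ : Fin n}
    (hδ : seqMod M V t₀ - seqMod M V' t₀ ≠ 0) (b b' d : ZMod M) :
    (univ.filter fun ω : VxxzSeed M n => vxxzHashX ω I = b ∧ vxxzHashY ω J = b' ∧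
        ω.2.2 ⬝ᵥ (seqMod M V - seqMod M V') = d).card * M ^ 3 = M ^ (n + 2) := by
  classical
  set δ := seqMod M V - seqMod M V' with hδdef
  have hδ0 : δ t₀ ≠ 0 := by simpa [hδdef] using hδ
  let F : VxxzSeed M n →+ ZMod M × ZMod M × ZMod M :=
    { toFun := fun ω => (vxxzHashX ω I, vxxzHashY ω J, ω.2.2 ⬝ᵥ δ)
      map_zero' := by simp [vxxzHashX, vxxzHashY]
      map_add' := fun ω ω' => by
        simp only [vxxzHashX, vxxzHashY, Prod.fst_add, Prod.snd_add, add_dotProduct, Prod.mk_add_mk,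
          Prod.mk.injEq]
        refine ⟨by ring, by ring, trivial⟩ }
  have hF : Function.Surjective F := by
    rintro ⟨x, y, z⟩
    let w : Fin n → ZMod M := Pi.single t₀ (z * (δ t₀)⁻¹)
    have hw : w ⬝ᵥ δ = z := by
      rw [single_dotProduct, mul_assoc, inv_mul_cancel₀ hδ0, mul_one]
    refine ⟨(x - w ⬝ᵥ seqMod M I, y - x + w ⬝ᵥ seqMod M I - w ⬝ᵥ seqMod M J, w), ?_⟩
    simp only [F, AddMonoidHom.coe_mk, ZeroHom.coe_mk, vxxzHashX, vxxzHashY, Prod.mk.injEq, hw]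
    exact ⟨by ring, by ring, trivial⟩
  have h := card_filter_mul_card_eq_card_of_surjective F hF (b, b', d)
  have hH : Fintype.card (ZMod M × ZMod M × ZMod M) = M ^ 3 := by
    simp only [Fintype.card_prod, ZMod.card]; ring
  rw [card_vxxzSeed, hH] at h
  rw [← h]
  congr 2
  refine Finset.filter_congr fun ω _ => ?_
  simp [F, Prod.ext_iff]

/-- **Claim 5.5, second part, triples sharing the `X`-block**: for block triples `X_I Y_J Z_K` and
`X_I Y_{J'} Z_{K'}` with `J ≠ J'` (entries `< M`), exactly `|Ω|/M³` seeds put both into bucket `b` —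
probability `1/M` conditioned on the first being in bucket `b` (`card_seeds_vxxzHash_bucket`).
[cite: VassilevskaWilliamsXuXuZhou2024, Claim 5.5] -/
theorem card_seeds_vxxzHash_bucket_shareX (hM : M ≠ 2) {P : ℕ} {I J K J' K' : Fin n → ℕ}
    (h : ∀ t, I t + J t + K t = P) (h' : ∀ t, I t + J' t + K' t = P) (hJ : ∀ t, J t < M)
    (hJ' : ∀ t, J' t < M) (hne : J ≠ J') (b : ZMod M) :
    (univ.filter fun ω : VxxzSeed M n =>
        (vxxzHashX ω I = b ∧ vxxzHashY ω J = b ∧ vxxzHashZ P ω K = b) ∧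
          (vxxzHashX ω I = b ∧ vxxzHashY ω J' = b ∧ vxxzHashZ P ω K' = b)).card * M ^ 3 =
      M ^ (n + 2) := by
  obtain ⟨t₀, ht₀⟩ := exists_seqMod_sub_ne_zero hJ hJ' hne
  rw [← card_seeds_vxxzHash_pair_diff I J ht₀ b b 0]
  congr 2
  refine Finset.filter_congr fun ω _ => ?_
  have hdiff : ω.2.2 ⬝ᵥ (seqMod M J - seqMod M J') = vxxzHashY ω J - vxxzHashY ω J' := by
    rw [vxxzHashY_apply, vxxzHashY_apply, dotProduct_sub]; ring
  rw [hdiff, sub_eq_zero]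
  constructor
  · rintro ⟨⟨hX, hY, -⟩, -, hY', -⟩
    exact ⟨hX, hY, hY.trans hY'.symm⟩
  · rintro ⟨hX, hY, hYY'⟩
    have hY' : vxxzHashY ω J' = b := hYY'.symm.trans hY
    exact ⟨⟨hX, hY, vxxzHashZ_eq_of_eq hM ω h hX hY⟩, hX, hY', vxxzHashZ_eq_of_eq hM ω h' hX hY'⟩

/-- **Claim 5.5, second part, triples sharing the `Y`-block** (`I ≠ I'`, entries `< M`).
[cite: VassilevskaWilliamsXuXuZhou2024, Claim 5.5] -/
theorem card_seeds_vxxzHash_bucket_shareY (hM : M ≠ 2) {P : ℕ} {I J K I' K' : Fin n → ℕ}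
    (h : ∀ t, I t + J t + K t = P) (h' : ∀ t, I' t + J t + K' t = P) (hI : ∀ t, I t < M)
    (hI' : ∀ t, I' t < M) (hne : I ≠ I') (b : ZMod M) :
    (univ.filter fun ω : VxxzSeed M n =>
        (vxxzHashX ω I = b ∧ vxxzHashY ω J = b ∧ vxxzHashZ P ω K = b) ∧
          (vxxzHashX ω I' = b ∧ vxxzHashY ω J = b ∧ vxxzHashZ P ω K' = b)).card * M ^ 3 =
      M ^ (n + 2) := by
  obtain ⟨t₀, ht₀⟩ := exists_seqMod_sub_ne_zero hI hI' hne
  rw [← card_seeds_vxxzHash_pair_diff I J ht₀ b b 0]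
  congr 2
  refine Finset.filter_congr fun ω _ => ?_
  have hdiff : ω.2.2 ⬝ᵥ (seqMod M I - seqMod M I') = vxxzHashX ω I - vxxzHashX ω I' := by
    rw [vxxzHashX_apply, vxxzHashX_apply, dotProduct_sub]; ring
  rw [hdiff, sub_eq_zero]
  constructor
  · rintro ⟨⟨hX, hY, -⟩, hX', -, -⟩
    exact ⟨hX, hY, hX.trans hX'.symm⟩
  · rintro ⟨hX, hY, hXX'⟩
    have hX' : vxxzHashX ω I' = b := hXX'.symm.trans hX
    exact ⟨⟨hX, hY, vxxzHashZ_eq_of_eq hM ω h hX hY⟩, hX', hY, vxxzHashZ_eq_of_eq hM ω h' hX' hY⟩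

/-- **Claim 5.5, second part, triples sharing the `Z`-block**: two different block triples
`X_I Y_J Z_K`, `X_{I'} Y_{J'} Z_K` have `I ≠ I'` (as `J = P − I − K`), and again exactly `|Ω|/M³`
seeds put both into bucket `b`. [cite: VassilevskaWilliamsXuXuZhou2024, Claim 5.5] -/
theorem card_seeds_vxxzHash_bucket_shareZ (hM : M ≠ 2) {P : ℕ} {I J K I' J' : Fin n → ℕ}
    (h : ∀ t, I t + J t + K t = P) (h' : ∀ t, I' t + J' t + K t = P) (hI : ∀ t, I t < M)
    (hI' : ∀ t, I' t < M) (hne : (I, J) ≠ (I', J')) (b : ZMod M) :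
    (univ.filter fun ω : VxxzSeed M n =>
        (vxxzHashX ω I = b ∧ vxxzHashY ω J = b ∧ vxxzHashZ P ω K = b) ∧
          (vxxzHashX ω I' = b ∧ vxxzHashY ω J' = b ∧ vxxzHashZ P ω K = b)).card * M ^ 3 =
      M ^ (n + 2) := by
  have hII' : I ≠ I' := by
    intro hI0
    apply hne
    subst hI0
    have : J = J' := funext fun t => by have := h t; have := h' t; omega
    rw [this]
  obtain ⟨t₀, ht₀⟩ := exists_seqMod_sub_ne_zero hI hI' hII'
  rw [← card_seeds_vxxzHash_pair_diff I J ht₀ b b 0]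
  congr 2
  refine Finset.filter_congr fun ω _ => ?_
  have hdiff : ω.2.2 ⬝ᵥ (seqMod M I - seqMod M I') = vxxzHashX ω I - vxxzHashX ω I' := by
    rw [vxxzHashX_apply, vxxzHashX_apply, dotProduct_sub]; ring
  rw [hdiff, sub_eq_zero]
  constructor
  · rintro ⟨⟨hX, hY, -⟩, hX', -, -⟩
    exact ⟨hX, hY, hX.trans hX'.symm⟩
  · rintro ⟨hX, hY, hXX'⟩
    have hX' : vxxzHashX ω I' = b := hXX'.symm.trans hX
    have hZ : vxxzHashZ P ω K = b := vxxzHashZ_eq_of_eq hM ω h hX hY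
    -- `h_Y(J') = 2 h_Z(K) − h_X(I') = b`
    have hap := vxxzHashX_add_vxxzHashY hM ω h' (I := I') (J := J') (K := K)
    rw [hX', hZ, two_mul] at hap
    have hY' : vxxzHashY ω J' = b := add_left_cancel hap
    exact ⟨⟨hX, hY, hZ⟩, hX', hY', hZ⟩

end Counts

end Literature.Computability.AlgebraicComplexity
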